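import Mathlib
import Summits.ResolutionOfSingularities.ResolutionOfSingularities.Theorems.WeightedInvariantDatumToEmbeddedQuotientSingularitiesGraded
import HarnessLib

/-!
# Degree zero of a graded ring: lying over, the comparison map, image gradings over a field

Topic: `Summits/ResolutionOfSingularities/ResolutionOfSingularities/Theorems`. Helper file of the
stub `stub_qs_base` of the line `Sketch` of the crux `Theses.WeightedInvariant.DatumToEmbedded`
(statement `stmt-ResolutionOfSingularities-0572`): the pure algebra behind "the good quotient
`Spec R → Spec R₀` of an affine scheme by a diagonalizable group is surjective" and behind the
graded `k`-algebra of a chart of a graded atlas.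

Let `R = ⨁ᵢ Rᵢ` be a commutative ring graded by an additive monoid (Mathlib `GradedRing 𝓡`) and
`ψ : C → R` a ring map with values in `R₀`.

* `decompose_mul_zero_mem_image`, `comap_map_eq_of_degreeZero` — if `ψ` maps ONTO `R₀` then for
  every ideal `p` of `C` the degree-`0` components of the elements of `p R` lie in `ψ(p)`; if
  moreover `ψ` is injective, `ψ⁻¹(p R) = p` (the Reynolds operator `x ↦ x₀` is `R₀`-linear);
  hence every prime of `C` is contracted from a prime of `R`
  (`exists_isPrime_comap_eq_of_degreeZero`): `Spec R → Spec R₀` is surjective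
  (Mumford, GIT, Thm 1.1 for diagonalizable groups).
* `exists_ringHom_gradeZero` — `ψ` factors through a ring map `τ : C → R₀` into Mathlib's ring
  `↥(𝓡 0)` (`SetLike.GradeZero.instCommRing`), bijective when `ψ` is injective onto `R₀`
  (`bijective_of_coe_eq`), with `τ⁻¹(Q ∩ R₀) = ψ⁻¹(Q)` (`comap_comap_of_coe_eq`).
* `exists_submodule_mem_iff` — for a ring map `π : A → R` from a ring graded by additive
  subgroups `𝒜 i` and a `k`-algebra structure on `R` whose structure map factors through
  `π(𝒜 0)`, the images `π(𝒜 i)` are `k`-submodules; they grade `R` when `π` is surjective with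
  homogeneous kernel (`nonempty_gradedAlgebra_of_mem_iff`, from `exists_gradedRing_map`).

No definitions are published (maps and gradings are returned existentially). Only Mathlib and the
sibling file `…QuotientSingularitiesGraded` are used. [folklore]
-/

-- the summit namespace repeats `ResolutionOfSingularities` by design (mandated namespace)
set_option linter.dupNamespace false

namespace Summit.ResolutionOfSingularities.ResolutionOfSingularities.Theorems.DatumToEmbedded.QuotientBase

open DirectSum
open Summit.ResolutionOfSingularities.ResolutionOfSingularities.Theorems.DatumToEmbedded.QuotientSingularities

/-! ## Degree-zero lying over -/

section LyingOver

variable {ι R C σ : Type*} [DecidableEq ι] [AddMonoid ι] [CommRing R] [CommRing C] [SetLike σ R]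
  [AddSubmonoidClass σ R] (𝓡 : ι → σ) [GradedRing 𝓡] {ψ : C →+* R}
  (hψ : ∀ c, ψ c ∈ 𝓡 0) (hsurj : ∀ x ∈ 𝓡 0, ∃ c, ψ c = x)

include hψ hsurj in
/-- If `ψ : C → R` maps onto the degree-`0` part of the graded ring `R`, then for every ideal
`p` of `C` and every `x ∈ p R`, all degree-`0` components `(r x)₀` lie in `ψ(p)` (the projection
`x ↦ x₀` is `R₀`-linear). [folklore] -/
theorem decompose_mul_zero_mem_image (p : Ideal C) {x : R} (hx : x ∈ p.map ψ) (r : R) :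
    (decompose 𝓡 (r * x) 0 : R) ∈ ψ '' p := by
  induction hx using Submodule.span_induction generalizing r with
  | mem x hx =>
    obtain ⟨c, hc, rfl⟩ := hx
    obtain ⟨c', hc'⟩ := hsurj _ (decompose 𝓡 r 0).2
    refine ⟨c' * c, p.mul_mem_left c' hc, ?_⟩
    rw [coe_decompose_mul_of_right_mem_zero 𝓡 (hψ c), map_mul, hc']
  | zero =>
    exact ⟨0, p.zero_mem, by
      rw [mul_zero, decompose_zero, DirectSum.zero_apply, ZeroMemClass.coe_zero, map_zero]⟩
  | add x y _ _ hx hy =>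
    obtain ⟨c, hc, hcx⟩ := hx r
    obtain ⟨d, hd, hdy⟩ := hy r
    exact ⟨c + d, p.add_mem hc hd, by
      rw [map_add, hcx, hdy, mul_add, decompose_add, DirectSum.add_apply, AddMemClass.coe_add]⟩
  | smul a x _ hx =>
    rw [smul_eq_mul, ← mul_assoc]
    exact hx (r * a)

include hψ hsurj in
/-- **Degree-zero lying over.** If `ψ : C → R` is injective with image the degree-`0` part of the
graded ring `R`, then `ψ⁻¹(p R) = p` for every ideal `p` of `C`. [folklore] -/
theorem comap_map_eq_of_degreeZero (hinj : Function.Injective ψ) (p : Ideal C) :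
    (p.map ψ).comap ψ = p := by
  refine le_antisymm (fun c hc => ?_) Ideal.le_comap_map
  rw [Ideal.mem_comap] at hc
  obtain ⟨c', hc', e⟩ := decompose_mul_zero_mem_image 𝓡 hψ hsurj p hc 1
  rw [one_mul, decompose_of_mem_same 𝓡 (hψ c)] at e
  rwa [← hinj e]

include hψ hsurj in
/-- Hence every prime of `C` is the contraction of a prime of `R`: the quotient map
`Spec R → Spec R₀` is surjective. [folklore; Mumford, GIT, Thm 1.1 (diagonalizable case)] -/
theorem exists_isPrime_comap_eq_of_degreeZero (hinj : Function.Injective ψ) (p : Ideal C)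
    [p.IsPrime] : ∃ Q : Ideal R, Q.IsPrime ∧ Q.comap ψ = p :=
  (Ideal.comap_map_eq_self_iff_of_isPrime p).1 (comap_map_eq_of_degreeZero 𝓡 hψ hsurj hinj p)

/-! ## The comparison map `C → R₀` -/

include hψ in
/-- A ring map `ψ : C → R` with values in degree `0` factors through Mathlib's ring `↥(𝓡 0)`
(`SetLike.GradeZero.instCommRing`). [folklore] -/
theorem exists_ringHom_gradeZero : ∃ τ : C →+* 𝓡 0, ∀ c, (τ c : R) = ψ c :=
  ⟨(ψ.codRestrict (SetLike.GradeZero.subsemiring 𝓡) hψ : C →+* SetLike.GradeZero.subsemiring 𝓡),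
    fun _ => rfl⟩

variable {𝓡} {τ : C →+* 𝓡 0} (hτ : ∀ c, (τ c : R) = ψ c)

include hτ in
/-- Such a factorisation `τ : C → R₀` composed with the inclusion `R₀ → R` is `ψ`. [folklore] -/
theorem algebraMap_comp_of_coe_eq : (algebraMap (𝓡 0) R).comp τ = ψ :=
  RingHom.ext hτ

include hτ hsurj in
/-- `τ : C ≅ R₀` is bijective when `ψ` is injective onto `R₀`. [folklore] -/
theorem bijective_of_coe_eq (hinj : Function.Injective ψ) : Function.Bijective τ := by
  refine ⟨fun c d h => hinj ?_, fun x => ?_⟩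
  · rw [← hτ, ← hτ, h]
  · obtain ⟨c, hc⟩ := hsurj x.1 x.2
    exact ⟨c, Subtype.ext ((hτ c).trans hc)⟩

include hτ in
/-- Contraction along `τ`: `τ⁻¹(Q ∩ R₀) = ψ⁻¹(Q)`. [folklore] -/
theorem comap_comap_of_coe_eq (Q : Ideal R) :
    (Q.comap (algebraMap (𝓡 0) R)).comap τ = Q.comap ψ := by
  rw [Ideal.comap_comap, algebraMap_comp_of_coe_eq hτ]

end LyingOver

/-! ## Image gradings as graded algebras over a field -/

section ImageAlgebra

variable {k : Type*} [Field k] {ι : Type*} [DecidableEq ι] [AddMonoid ι]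
  {A R : Type*} [CommRing A] [CommRing R] [Algebra k R]
  (𝒜 : ι → AddSubgroup A) [GradedRing 𝒜] (π : A →+* R) {κ : k →+* A}
  (hκ : ∀ c, κ c ∈ 𝒜 0) (halg : ∀ c, algebraMap k R c = π (κ c))

include hκ halg in
/-- **The image pieces** `π(𝒜 i)` of a grading by additive subgroups along a ring map
`π : A → R` are `k`-submodules of `R` as soon as the structure map of `R` factors through
`𝒜 0` (constants have degree `0`). [folklore] -/
theorem exists_submodule_mem_iff :
    ∃ 𝓡 : ι → Submodule k R, ∀ i x, x ∈ 𝓡 i ↔ x ∈ (𝒜 i).map π.toAddMonoidHom := by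
  haveI : SetLike.GradedMonoid fun i => (𝒜 i).map π.toAddMonoidHom := gradedMonoid_map 𝒜 π
  refine ⟨fun i =>
    { ((𝒜 i).map π.toAddMonoidHom).toAddSubmonoid with
      smul_mem' := fun c x (hx : x ∈ (𝒜 i).map π.toAddMonoidHom) => ?_ }, fun i x => Iff.rfl⟩
  have h0 : algebraMap k R c ∈ (𝒜 0).map π.toAddMonoidHom :=
    halg c ▸ AddSubgroup.mem_map_of_mem π.toAddMonoidHom (hκ c)
  have h := SetLike.mul_mem_graded (A := fun i => (𝒜 i).map π.toAddMonoidHom) h0 hx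
  rw [zero_add] at h
  change algebraMap k R c * x ∈ (𝒜 i).map π.toAddMonoidHom at h
  change c • x ∈ (𝒜 i).map π.toAddMonoidHom
  rw [Algebra.smul_def]
  exact h

/-- **The image grading is a grading**: pieces with the elements of the `π(𝒜 i)` grade `R`
when `π` is surjective with homogeneous kernel (the grading of `A ⧸ ker π` transported to `R`,
`exists_gradedRing_map`). [folklore] -/
theorem nonempty_gradedAlgebra_of_mem_iff (𝓡 : ι → Submodule k R)
    (hmem : ∀ i x, x ∈ 𝓡 i ↔ x ∈ (𝒜 i).map π.toAddMonoidHom) (hπ : Function.Surjective π)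
    (hker : (RingHom.ker π).IsHomogeneous 𝒜) : Nonempty (GradedAlgebra 𝓡) := by
  obtain ⟨_, _⟩ := exists_gradedRing_map 𝒜 π hπ hker
  exact nonempty_gradedRing_of_mem_iff (fun i => (𝒜 i).map π.toAddMonoidHom) _ hmem

end ImageAlgebra

/-! ## Registered sub-goal -/

/-- **Sub-goal `stub_qs_baseLyingOver`** of `stub_qs_base` (registered on the crux item for this
file): degree-zero lying over — if `ψ : C → R` is injective with image the degree-`0` part of a
graded commutative ring `R`, every prime of `C` is contracted from a prime of `R`
(`exists_isPrime_comap_eq_of_degreeZero`). [folklore; Mumford, GIT, Thm 1.1] -/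
theorem stub_qs_baseLyingOver :
    ∀ {ι R C σ : Type} [DecidableEq ι] [AddMonoid ι] [CommRing R] [CommRing C] [SetLike σ R]
      [AddSubmonoidClass σ R] (𝓡 : ι → σ) [GradedRing 𝓡] (ψ : C →+* R),
      (∀ c, ψ c ∈ 𝓡 0) → (∀ x ∈ 𝓡 0, ∃ c, ψ c = x) → Function.Injective ψ →
      ∀ (p : Ideal C) [p.IsPrime], ∃ Q : Ideal R, Q.IsPrime ∧ Q.comap ψ = p := by
  intro ι R C σ _ _ _ _ _ _ 𝓡 _ ψ hψ hsurj hinj p _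
  exact exists_isPrime_comap_eq_of_degreeZero 𝓡 hψ hsurj hinj p

end Summit.ResolutionOfSingularities.ResolutionOfSingularities.Theorems.DatumToEmbedded.QuotientBase
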